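import Summits.QuantumFields.BalabanUV.T4Continuum.Support.NE3CovLiftCurl
import Summits.QuantumFields.BalabanUV.T4Continuum.Support.AveragingDeficitNearIdentity
import HarnessLib

/-!
# NE7GaugedGradientNearFlat — supplier stub (S-d′) brick (ROAD-G107 §6 (c)): THE PLAIN GRADIENT OF A GAUGE-TRANSFORMED FIELD AGAINST THE COVARIANT GRADIENT —
# `Y^{u}(x+e_μ, κ) − Y^{u}(x, κ) = Ad_{u(x+e_κ)}[Ad_{W(x+e_κ,μ)} Y(x+e_μ,κ) − Y(x,κ)] + (1 − Ad_{W^{u}(x+e_κ,μ)})·Y^{u}(x+e_μ,κ)`, so at a `δ`-flat gauged background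
# (`‖W^{u}(b) − 1‖ ≤ δ`) the plain gradient of `Y^{u}` is the covariant gradient of `Y` up to `2δ·‖Y‖` — the letter `G` of `NE7CutoffSecondOrderData` from the bootstrap quantity

Cell `pub-balaban`, rung (B)+1 sub-cell t4, lineage `b2b-balaban-t4-ne7-p1`, generation 107 (CRUX PROVER NE7 #1 = OWNER of BINDER row NE7).
Memo `t4/b2b-balaban-t4-ne7-p1-g107/ROAD-G107.md` §6.
WHY.  In the curved C¹ bootstrap the slice field `Y` is gauged by the comb `u` (`W^{u}` is `δ = O(M C₃ x)`-flat on the working region, gen 101's `comb_near_flat`) and cut off; the flat C¹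
letter and `NE7CutoffSecondOrderData` take PLAIN lattice gradients of `Y^{u}`, the bootstrap quantity is the COVARIANT gradient of `Y` (the socket's (Gᶜ_w)); THIS FILE is the exchange,
in both directions, with the exact identity behind it (the direction field transforms at the END point of its bond, `AveragingDeficitLocality.dirGauge`).
WHAT ([folklore]; 0 def, 0 sorry; any dimension, any `n`).  `gaugeAct_end_mul` (`W^{u}(x+e_κ,μ)·u(x+e_κ+e_μ) = u(x+e_κ)·W(x+e_κ,μ)`), **`fdiff_dirGauge_eq`** (the identity),
**`norm_fdiff_dirGauge_le`** (`‖ΔY^{u}‖ ≤ ‖∇_W Y‖ + 2δ‖Y(x+e_μ,κ)‖`), **`norm_covDiff_le_fdiff_dirGauge`** (`‖∇_W Y‖ ≤ ‖ΔY^{u}‖ + 2δ‖Y(x+e_μ,κ)‖`), and the uniform forms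
`plainGrad_letter_of_covGrad` ∕ `covGrad_letter_of_plainGrad` (`G_plain ≤ G_cov + 2δS` and back, given `‖W^{u}(b) − 1‖ ≤ δ` on all bonds and `‖Y‖ ≤ S`).
HONEST FRAMING (page 1): gauge-covariance algebra on OUR objects; nothing of Bałaban's asserted; nothing of NE3∕NE7 discharged; spine count = dagwriter∕referees' call; FIXED FINITE T⁴,
rung (B)+1 — NOT infinite volume, NOT mass gap, NOT BetaPertH, NOT Clay.
-/

set_option autoImplicit false

open scoped BigOperators Matrix.Norms.L2Operator
open NormedSpace

namespace Summit.QuantumFields.BalabanUV.T4Continuum.NE7GaugedGradientNearFlat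

open Literature.MathematicalPhysics.QuantumFieldTheory.Balaban1983to89
open B7Prop1Explicit B7Prop2Explicit
open T4AveragingDeficitWall (Ad IsUnitaryCfg)
open T4AveragingDeficitNonAbelian (Ad_mul Ad_sub)
open AveragingDeficitTransport (norm_Ad_of_unitary)
open AveragingDeficitNearIdentity (norm_Ad_sub_le)
open AveragingDeficitLocality (dirGauge)

noncomputable section

variable {d : ℕ} {n : Type*} [Fintype n] [DecidableEq n]

/-- The gauged bond variable recombined: `W^{u}(x+e_κ,μ) · u(x+e_κ+e_μ) = u(x+e_κ) · W(x+e_κ,μ)`. [folklore] -/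
theorem gaugeAct_end_mul (u : Site d → (Matrix n n ℂ)ˣ) (W : Site d → Fin d → (Matrix n n ℂ)ˣ) (x : Site d) (κ μ : Fin d) :
    gaugeAct u W (x + e κ) μ * u (x + e κ + e μ) = u (x + e κ) * W (x + e κ) μ := by
  show u (x + e κ) * W (x + e κ) μ * (u (x + e κ + e μ))⁻¹ * u (x + e κ + e μ) = u (x + e κ) * W (x + e κ) μ
  rw [inv_mul_cancel_right]

/-- **THE IDENTITY**: `Y^{u}(x+e_μ,κ) − Y^{u}(x,κ) = Ad_{u(x+e_κ)}[Ad_{W(x+e_κ,μ)} Y(x+e_μ,κ) − Y(x,κ)] + (Y^{u}(x+e_μ,κ) − Ad_{W^{u}(x+e_κ,μ)} Y^{u}(x+e_μ,κ))`. [folklore] -/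
theorem fdiff_dirGauge_eq (u : Site d → (Matrix n n ℂ)ˣ) (W : Site d → Fin d → (Matrix n n ℂ)ˣ) (Y : Site d → Fin d → Matrix n n ℂ) (x : Site d) (μ κ : Fin d) :
    dirGauge u Y (x + e μ) κ - dirGauge u Y x κ
      = Ad (u (x + e κ)) (Ad (W (x + e κ) μ) (Y (x + e μ) κ) - Y x κ)
        + (dirGauge u Y (x + e μ) κ - Ad (gaugeAct u W (x + e κ) μ) (dirGauge u Y (x + e μ) κ)) := by
  have h1 : Ad (gaugeAct u W (x + e κ) μ) (dirGauge u Y (x + e μ) κ) = Ad (u (x + e κ)) (Ad (W (x + e κ) μ) (Y (x + e μ) κ)) := by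
    show Ad (gaugeAct u W (x + e κ) μ) (Ad (u (x + e μ + e κ)) (Y (x + e μ) κ)) = _
    rw [← Ad_mul, ← Ad_mul, show x + e μ + e κ = x + e κ + e μ by abel, gaugeAct_end_mul]
  have h2 : dirGauge u Y x κ = Ad (u (x + e κ)) (Y x κ) := rfl
  rw [Ad_sub, ← h1, h2]
  abel

/-- **PLAIN FROM COVARIANT**: `W, u` unitary, `‖W^{u}(x+e_κ,μ) − 1‖ ≤ δ` ⟹ `‖Y^{u}(x+e_μ,κ) − Y^{u}(x,κ)‖ ≤ ‖Ad_{W(x+e_κ,μ)}Y(x+e_μ,κ) − Y(x,κ)‖ + 2δ‖Y(x+e_μ,κ)‖`. [folklore] -/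
theorem norm_fdiff_dirGauge_le [Nonempty n] {W : Site d → Fin d → (Matrix n n ℂ)ˣ} (hW : IsUnitaryCfg W) {u : Site d → (Matrix n n ℂ)ˣ}
    (hu : ∀ y, u y ∈ unitaryUnits (Matrix n n ℂ)) (Y : Site d → Fin d → Matrix n n ℂ) (x : Site d) (μ κ : Fin d) {δ : ℝ}
    (hδ : ‖((gaugeAct u W (x + e κ) μ : (Matrix n n ℂ)ˣ) : Matrix n n ℂ) - 1‖ ≤ δ) :
    ‖dirGauge u Y (x + e μ) κ - dirGauge u Y x κ‖ ≤ ‖Ad (W (x + e κ) μ) (Y (x + e μ) κ) - Y x κ‖ + 2 * δ * ‖Y (x + e μ) κ‖ := by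
  have hgu : gaugeAct u W (x + e κ) μ ∈ unitaryUnits (Matrix n n ℂ) :=
    (unitaryUnits _).mul_mem ((unitaryUnits _).mul_mem (hu _) (hW _ _)) ((unitaryUnits _).inv_mem (hu _))
  have hδ0 : 0 ≤ δ := (norm_nonneg _).trans hδ
  rw [fdiff_dirGauge_eq u W Y x μ κ]
  refine (norm_add_le _ _).trans (add_le_add ?_ ?_)
  · rw [norm_Ad_of_unitary (hu _)]
  · rw [norm_sub_rev]
    calc ‖Ad (gaugeAct u W (x + e κ) μ) (dirGauge u Y (x + e μ) κ) - dirGauge u Y (x + e μ) κ‖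
        ≤ 2 * ‖((gaugeAct u W (x + e κ) μ : (Matrix n n ℂ)ˣ) : Matrix n n ℂ) - 1‖ * ‖dirGauge u Y (x + e μ) κ‖ := norm_Ad_sub_le hgu _
      _ ≤ 2 * δ * ‖Y (x + e μ) κ‖ := by
          have e1 : ‖dirGauge u Y (x + e μ) κ‖ = ‖Y (x + e μ) κ‖ := norm_Ad_of_unitary (hu _) _
          rw [e1]
          exact mul_le_mul_of_nonneg_right (mul_le_mul_of_nonneg_left hδ (by norm_num)) (norm_nonneg _)

/-- **COVARIANT FROM PLAIN**: under the same hypotheses `‖Ad_{W(x+e_κ,μ)}Y(x+e_μ,κ) − Y(x,κ)‖ ≤ ‖Y^{u}(x+e_μ,κ) − Y^{u}(x,κ)‖ + 2δ‖Y(x+e_μ,κ)‖`. [folklore] -/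
theorem norm_covDiff_le_fdiff_dirGauge [Nonempty n] {W : Site d → Fin d → (Matrix n n ℂ)ˣ} (hW : IsUnitaryCfg W) {u : Site d → (Matrix n n ℂ)ˣ}
    (hu : ∀ y, u y ∈ unitaryUnits (Matrix n n ℂ)) (Y : Site d → Fin d → Matrix n n ℂ) (x : Site d) (μ κ : Fin d) {δ : ℝ}
    (hδ : ‖((gaugeAct u W (x + e κ) μ : (Matrix n n ℂ)ˣ) : Matrix n n ℂ) - 1‖ ≤ δ) :
    ‖Ad (W (x + e κ) μ) (Y (x + e μ) κ) - Y x κ‖ ≤ ‖dirGauge u Y (x + e μ) κ - dirGauge u Y x κ‖ + 2 * δ * ‖Y (x + e μ) κ‖ := by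
  have hgu : gaugeAct u W (x + e κ) μ ∈ unitaryUnits (Matrix n n ℂ) :=
    (unitaryUnits _).mul_mem ((unitaryUnits _).mul_mem (hu _) (hW _ _)) ((unitaryUnits _).inv_mem (hu _))
  have hid := fdiff_dirGauge_eq u W Y x μ κ
  have e2 : Ad (u (x + e κ)) (Ad (W (x + e κ) μ) (Y (x + e μ) κ) - Y x κ)
      = (dirGauge u Y (x + e μ) κ - dirGauge u Y x κ) - (dirGauge u Y (x + e μ) κ - Ad (gaugeAct u W (x + e κ) μ) (dirGauge u Y (x + e μ) κ)) := by
    rw [hid]; abel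
  have hrem : ‖dirGauge u Y (x + e μ) κ - Ad (gaugeAct u W (x + e κ) μ) (dirGauge u Y (x + e μ) κ)‖ ≤ 2 * δ * ‖Y (x + e μ) κ‖ := by
    rw [norm_sub_rev]
    calc ‖Ad (gaugeAct u W (x + e κ) μ) (dirGauge u Y (x + e μ) κ) - dirGauge u Y (x + e μ) κ‖
        ≤ 2 * ‖((gaugeAct u W (x + e κ) μ : (Matrix n n ℂ)ˣ) : Matrix n n ℂ) - 1‖ * ‖dirGauge u Y (x + e μ) κ‖ := norm_Ad_sub_le hgu _
      _ ≤ 2 * δ * ‖Y (x + e μ) κ‖ := by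
          have e1 : ‖dirGauge u Y (x + e μ) κ‖ = ‖Y (x + e μ) κ‖ := norm_Ad_of_unitary (hu _) _
          rw [e1]
          exact mul_le_mul_of_nonneg_right (mul_le_mul_of_nonneg_left hδ (by norm_num)) (norm_nonneg _)
  calc ‖Ad (W (x + e κ) μ) (Y (x + e μ) κ) - Y x κ‖ = ‖Ad (u (x + e κ)) (Ad (W (x + e κ) μ) (Y (x + e μ) κ) - Y x κ)‖ :=
        (norm_Ad_of_unitary (hu _) _).symm
    _ = ‖(dirGauge u Y (x + e μ) κ - dirGauge u Y x κ) - (dirGauge u Y (x + e μ) κ - Ad (gaugeAct u W (x + e κ) μ) (dirGauge u Y (x + e μ) κ))‖ := by rw [e2]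
    _ ≤ ‖dirGauge u Y (x + e μ) κ - dirGauge u Y x κ‖ + ‖dirGauge u Y (x + e μ) κ - Ad (gaugeAct u W (x + e κ) μ) (dirGauge u Y (x + e μ) κ)‖ := norm_sub_le _ _
    _ ≤ _ := add_le_add le_rfl hrem

/-- **THE LETTER `G` OF THE GAUGED FIELD** (uniform form): `‖W^{u}(b) − 1‖ ≤ δ` on every bond, `‖Y‖ ≤ S`, covariant gradient `≤ G` ⟹ plain gradient of `Y^{u}` `≤ G + 2δS`. [folklore] -/
theorem plainGrad_letter_of_covGrad [Nonempty n] {W : Site d → Fin d → (Matrix n n ℂ)ˣ} (hW : IsUnitaryCfg W) {u : Site d → (Matrix n n ℂ)ˣ}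
    (hu : ∀ y, u y ∈ unitaryUnits (Matrix n n ℂ)) (Y : Site d → Fin d → Matrix n n ℂ) {δ S G : ℝ}
    (hδ : ∀ (y : Site d) (ν : Fin d), ‖((gaugeAct u W y ν : (Matrix n n ℂ)ˣ) : Matrix n n ℂ) - 1‖ ≤ δ) (hS : ∀ y κ, ‖Y y κ‖ ≤ S)
    (hG : ∀ (y : Site d) (μ κ : Fin d), ‖Ad (W (y + e κ) μ) (Y (y + e μ) κ) - Y y κ‖ ≤ G) (x : Site d) (μ κ : Fin d) :
    ‖dirGauge u Y (x + e μ) κ - dirGauge u Y x κ‖ ≤ G + 2 * δ * S := by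
  have hδ0 : 0 ≤ δ := (norm_nonneg _).trans (hδ x μ)
  exact (norm_fdiff_dirGauge_le hW hu Y x μ κ (hδ _ _)).trans (add_le_add (hG x μ κ) (mul_le_mul_of_nonneg_left (hS _ _) (by positivity)))

/-- **THE COVARIANT GRADIENT FROM THE PLAIN ONE** (uniform form): plain gradient of `Y^{u}` `≤ G′` ⟹ covariant gradient of `Y` `≤ G′ + 2δS`. [folklore] -/
theorem covGrad_letter_of_plainGrad [Nonempty n] {W : Site d → Fin d → (Matrix n n ℂ)ˣ} (hW : IsUnitaryCfg W) {u : Site d → (Matrix n n ℂ)ˣ}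
    (hu : ∀ y, u y ∈ unitaryUnits (Matrix n n ℂ)) (Y : Site d → Fin d → Matrix n n ℂ) {δ S G' : ℝ}
    (hδ : ∀ (y : Site d) (ν : Fin d), ‖((gaugeAct u W y ν : (Matrix n n ℂ)ˣ) : Matrix n n ℂ) - 1‖ ≤ δ) (hS : ∀ y κ, ‖Y y κ‖ ≤ S)
    (hG' : ∀ (y : Site d) (μ κ : Fin d), ‖dirGauge u Y (y + e μ) κ - dirGauge u Y y κ‖ ≤ G') (x : Site d) (μ κ : Fin d) :
    ‖Ad (W (x + e κ) μ) (Y (x + e μ) κ) - Y x κ‖ ≤ G' + 2 * δ * S := by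
  have hδ0 : 0 ≤ δ := (norm_nonneg _).trans (hδ x μ)
  exact (norm_covDiff_le_fdiff_dirGauge hW hu Y x μ κ (hδ _ _)).trans (add_le_add (hG' x μ κ) (mul_le_mul_of_nonneg_left (hS _ _) (by positivity)))

end

end Summit.QuantumFields.BalabanUV.T4Continuum.NE7GaugedGradientNearFlat
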